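import Mathlib.Geometry.Manifold.BumpFunction
import Literature.Topology.Immersions.FrameCoordinates
import Literature.Topology.InductiveConstruction
import HarnessLib

/-!
# Open parallelizable manifolds immerse in `ℝⁿ`: formal submersions and the induction scheme

Topic `Literature/Topology/Immersions`; part of the proof programme for the named fact
`Literature.Topology.Immersions.Phillips1967_exists_isLocalDiffeomorph_of_isParallelizable`
(Phillips 1967, Cor. 8.2, "if": *an open parallelizable `n`-manifold submerges in `ℝⁿ`*), in the
frame form of `OpenParallelizableImmersionFrames.lean`: a continuous global frame `σ = (σᵢ)ᵢ` of
`TM` being fixed, a `C^∞` map `f : M → ℝⁿ` is a local diffeomorphism iff its **frame derivative**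
`J_σ f (x) = (d f_x (σᵢ x))ᵢ` is a linearly independent family at every `x`.

Phillips proves Cor. 8.2 through Theorem B by induction over a handle presentation
`M = ⋃ Uⱼ` (§1, Cor. 1.2), carrying along the induction not only a submersion of `Uⱼ` but the
homotopy-theoretic datum that its gradient frame lies in the prescribed component of
`Sect TₙUⱼ` (§6). We carry this datum in the form used by Gromov and Eliashberg–Mishachev
(*Holonomic approximation and Gromov's h-principle* (2001), §2.1: formal solutions of open
`Diff V`-invariant differential relations; Gromov's theorem 2.1.2): a **formal
solution** of the submersion relation, i.e. a pair `(f, Ψ)` of a smooth map `f` and a continuous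
field `Ψ : M → (ℝⁿ)ⁿ` of linearly independent families (a fibrewise-invertible bundle map
`TM → Tℝⁿ` read on the frame), which is **holonomic** (`Ψ = J_σ f`) near a subset `U`. This
avoids frame bundles, function-space topologies and homotopies altogether.

* `Literature.Topology.Immersions.HolonomicNear σ f Ψ U` — `(f, Ψ)` is a global formal
  submersion of `M` into `ℝⁿ`, holonomic on a neighbourhood of `U`.
* API: `HolonomicNear.mono`, `.frameDeriv_eq`, `.linearIndependent_frameDeriv`,
  `.isLocalDiffeomorphAt`, `.of_isOpen` (constructor on an open set), `.congr` (changing `f`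
  away from a neighbourhood of `U`).
* `Literature.Topology.Immersions.exists_contMDiff_linearIndependent_frameDeriv_of_exhaustion` —
  **the induction scheme** (Phillips, proof of Thm. A, pp. 194–195, existence part, via the
  tree's `Literature.Topology.exists_forall_of_exhaustion`): if `K₀ ⊆ K₁ ⊆ ⋯ ⊆ M` have
  interiors covering `M`, some formal submersion is holonomic near `K₁`, and every formal
  submersion holonomic near `K_{j+1}` can be replaced by one holonomic near `K_{j+2}` with the
  same map `f` on `K j`, then `M` carries a `C^∞` map with everywhere linearly independent frame
  derivative, i.e. a `C^∞` local diffeomorphism into `ℝⁿ`.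
* `Literature.Topology.Immersions.Phillips1967_exists_isLocalDiffeomorph_of_isParallelizable_of_exhaustion`
  — **reduction of the fact** to the existence, on every connected non-compact framed
  `n`-manifold (`2 ≤ n`), of such an exhaustion with the base and step properties (the base is
  supplied near any point by `exists_holonomicNear_nhds` below; the steps are Phillips' §§3–6:
  collar-like enlargements and handles of index `< n`).
* `Literature.Topology.Immersions.exists_holonomicNear_nhds` — **the base of the induction**
  (Phillips §2 in this language; "any section is holonomic over any point", EM 2001 §1.1):
  every point has a
  neighbourhood `V` with a formal submersion holonomic near `V` — `f` is a cut-off chart `φ`,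
  and `Ψ x = J_σ φ (ρ x)` for a continuous map `ρ : M → source φ` equal to the identity near the
  point and constant far away (radial contraction in the chart).

## References

* A. Phillips, *Submersions of open manifolds*, Topology **6** (1967), 171–206: §2, §6, proof of
  Thm. A pp. 194–195, Cor. 8.2 p. 196. [Phillips1967]
* Y. Eliashberg, N. Mishachev, *Holonomic approximation and Gromov's h-principle*,
  arXiv:math/0101196 (2001), §1.1 (holonomic sections), §2.1 (formal solutions, Gromov's
  theorem 2.1.2 for open `Diff V`-invariant relations over open manifolds).
  [EliashbergMishachev2001] (held: `paper:arxiv-math_0101196`)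
* Y. Eliashberg, N. Mishachev, *Introduction to the h-principle*, GSM 48, AMS (2002).
  [EliashbergMishachev2002]
-/

open scoped Manifold ContDiff Topology
open Set Function Filter Bundle Module Metric

noncomputable section

namespace Literature.Topology.Immersions

/-- Local notation: `𝔼 n` is the model Euclidean space `EuclideanSpace ℝ (Fin n)`. -/
local notation "𝔼 " n:arg => EuclideanSpace ℝ (Fin n)

variable {n : ℕ} {M : Type*} [TopologicalSpace M] [ChartedSpace (𝔼 n) M]

/-! ### Formal submersions -/

/-- **Formal submersion, holonomic near `U`** (Gromov 1969; Eliashberg–Mishachev 2001, §2.1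
"formal solution … holonomic", for the submersion relation `M → ℝⁿ`, read on a frame `σ`). The pair `(f, Ψ)` consists of a `C^∞`
map `f : M → ℝⁿ` and a *continuous* field `Ψ : M → (ℝⁿ)ⁿ` of *linearly independent* families
— a formal solution of the (open, `Diff M`-invariant) relation "the differential is invertible",
expressed on the frame — which is **holonomic on a neighbourhood of `U`**: `Ψ = J_σ f` there.
In Phillips' language (§6): a submersion of a neighbourhood of `U` together with an extension of
its gradient `n`-frame to a section of `TₙM` over all of `M`.
[cite: EliashbergMishachev2001, §2.1] -/
structure HolonomicNear (σ : Fin n → M → 𝔼 n) (f : M → 𝔼 n) (Ψ : M → Fin n → 𝔼 n)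
    (U : Set M) : Prop where
  /-- the map is `C^∞` on all of `M` -/
  contMDiff : ContMDiff (𝓡 n) (𝓡 n) ∞ f
  /-- the formal derivative is continuous … -/
  continuous : Continuous Ψ
  /-- … with linearly independent values everywhere (a formal submersion) … -/
  linearIndependent : ∀ x, LinearIndependent ℝ (Ψ x)
  /-- … and agrees with the frame derivative of `f` on a neighbourhood of `U` (holonomy). -/
  eventually_eq : ∀ᶠ x in 𝓝ˢ U, Ψ x = frameDeriv σ f x

namespace HolonomicNear

variable {σ : Fin n → M → 𝔼 n} {f g : M → 𝔼 n} {Ψ : M → Fin n → 𝔼 n} {U V : Set M}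

/-- Holonomy near `U` implies holonomy near any `V ⊆ U`. [folklore] -/
theorem mono (h : HolonomicNear σ f Ψ U) (hV : V ⊆ U) : HolonomicNear σ f Ψ V :=
  ⟨h.contMDiff, h.continuous, h.linearIndependent, nhdsSet_mono hV h.eventually_eq⟩

/-- On `U` itself the formal derivative is the frame derivative. [folklore] -/
theorem frameDeriv_eq (h : HolonomicNear σ f Ψ U) {x : M} (hx : x ∈ U) :
    Ψ x = frameDeriv σ f x :=
  h.eventually_eq.self_of_nhdsSet x hx

/-- The holonomy equation holds on some open neighbourhood of `U`. [folklore] -/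
theorem exists_isOpen (h : HolonomicNear σ f Ψ U) :
    ∃ W : Set M, IsOpen W ∧ U ⊆ W ∧ ∀ x ∈ W, Ψ x = frameDeriv σ f x := by
  obtain ⟨W, hW, hUW, hWeq⟩ := eventually_nhdsSet_iff_exists.1 h.eventually_eq
  exact ⟨W, hW, hUW, hWeq⟩

/-- On `U` the frame derivative of `f` is a linearly independent family. [folklore] -/
theorem linearIndependent_frameDeriv (h : HolonomicNear σ f Ψ U) {x : M} (hx : x ∈ U) :
    LinearIndependent ℝ (frameDeriv σ f x) :=
  h.frameDeriv_eq hx ▸ h.linearIndependent x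

/-- A formal submersion holonomic near `U` is a genuine local diffeomorphism at the points of
`U` (inverse function theorem: `isInvertible_of_linearIndependent_map` and the tree's
`Literature.Topology.FourManifolds.isLocalDiffeomorphAt_of_mfderiv`). [folklore] -/
theorem isLocalDiffeomorphAt [IsManifold (𝓡 n) ∞ M] (h : HolonomicNear σ f Ψ U) {x : M}
    (hx : x ∈ U) : IsLocalDiffeomorphAt (𝓡 n) (𝓡 n) ∞ f x := by
  obtain ⟨L, hL⟩ := isInvertible_of_linearIndependent_map
    ((Fintype.card_fin n).trans finrank_euclideanSpace_fin.symm) (mfderiv (𝓡 n) (𝓡 n) f x)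
    (h.linearIndependent_frameDeriv hx)
  exact Literature.Topology.FourManifolds.isLocalDiffeomorphAt_of_mfderiv isOpen_univ (mem_univ x)
    h.contMDiff.contMDiffOn (by norm_num) L hL.symm

/-- Constructor on an open set: it suffices to check the holonomy equation on `U` itself.
[folklore] -/
theorem of_isOpen (hU : IsOpen U) (hf : ContMDiff (𝓡 n) (𝓡 n) ∞ f) (hΨ : Continuous Ψ)
    (hli : ∀ x, LinearIndependent ℝ (Ψ x)) (heq : ∀ x ∈ U, Ψ x = frameDeriv σ f x) :
    HolonomicNear σ f Ψ U :=
  ⟨hf, hΨ, hli, hU.mem_nhdsSet_self |> mem_of_superset <| fun x hx => heq x hx⟩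

/-- Changing the map away from `U`: if `g` is `C^∞` and agrees with `f` on a neighbourhood of
`U`, then `(g, Ψ)` is again holonomic near `U`. [folklore] -/
theorem congr (h : HolonomicNear σ f Ψ U) (hg : ContMDiff (𝓡 n) (𝓡 n) ∞ g)
    (hfg : ∀ᶠ x in 𝓝ˢ U, f x = g x) : HolonomicNear σ g Ψ U := by
  refine ⟨hg, h.continuous, h.linearIndependent, ?_⟩
  obtain ⟨W, hW, hUW, hWeq⟩ := eventually_nhdsSet_iff_exists.1 hfg
  filter_upwards [h.eventually_eq, hW.mem_nhdsSet.2 hUW] with x hx hxW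
  rw [hx]
  exact frameDeriv_congr_of_eventuallyEq
    (mem_of_superset (hW.mem_nhds hxW) fun y hy => hWeq y hy)

end HolonomicNear

/-! ### The induction scheme -/

section Scheme

variable {σ : Fin n → M → 𝔼 n}

/-- **The induction scheme for submersions of an exhausted manifold** (existence part of the
inverse-limit step in Phillips' proof of Thm. A, pp. 194–195, in the formal-solution language).
Let `K₀ ⊆ K₁ ⊆ ⋯` be subsets of `M` whose interiors cover `M`. Suppose some formal submersion
`(f, Ψ)` is holonomic near `K 1`, and that every formal submersion holonomic near `K (j+1)` can
be replaced by one holonomic near `K (j+2)` whose map agrees with the old one on `K j`. Then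
there is a `C^∞` map `F : M → ℝⁿ` whose frame derivative is linearly independent at every
point (the successive maps are eventually constant near each point:
`Literature.Topology.exists_forall_of_exhaustion`).
[cite: Phillips1967, proof of Thm. A, pp. 194–195] -/
theorem exists_contMDiff_linearIndependent_frameDeriv_of_exhaustion (K : ℕ → Set M)
    (hmono : ∀ j, K j ⊆ K (j + 1)) (hcov : ∀ x, ∃ j, x ∈ interior (K j))
    (h0 : ∃ (f : M → 𝔼 n) (Ψ : M → Fin n → 𝔼 n), HolonomicNear σ f Ψ (K 1))
    (hstep : ∀ (j : ℕ) (f : M → 𝔼 n) (Ψ : M → Fin n → 𝔼 n), HolonomicNear σ f Ψ (K (j + 1)) →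
      ∃ (g : M → 𝔼 n) (Φ : M → Fin n → 𝔼 n), HolonomicNear σ g Φ (K (j + 2)) ∧ EqOn g f (K j)) :
    ∃ F : M → 𝔼 n, ContMDiff (𝓡 n) (𝓡 n) ∞ F ∧ ∀ x, LinearIndependent ℝ (frameDeriv σ F x) := by
  -- stage predicate: `∃ Ψ, (f, Ψ)` holonomic near `K (j+1)`; target: smooth at `x` with
  -- linearly independent frame derivative at `x` (a germ property)
  obtain ⟨F, hF⟩ := Literature.Topology.exists_forall_of_exhaustion K hmono hcov
    (fun j f => ∃ Ψ : M → Fin n → 𝔼 n, HolonomicNear σ f Ψ (K (j + 1)))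
    (fun x f => ContMDiffAt (𝓡 n) (𝓡 n) ∞ f x ∧ LinearIndependent ℝ (frameDeriv σ f x))
    (fun x f g hfg hf => ⟨hf.1.congr_of_eventuallyEq hfg.symm,
      frameDeriv_congr_of_eventuallyEq hfg ▸ hf.2⟩)
    (fun j f ⟨Ψ, hΨ⟩ x hx => ⟨hΨ.contMDiff x,
      hΨ.linearIndependent_frameDeriv (hmono j (interior_subset hx))⟩)
    h0 (fun j f ⟨Ψ, hΨ⟩ => by
      obtain ⟨g, Φ, hg, hgf⟩ := hstep j f Ψ hΨ
      exact ⟨g, ⟨Φ, hg⟩, hgf⟩)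
  exact ⟨F, fun x => (hF x).1, fun x => (hF x).2⟩

/-- **Reduction of Phillips' Cor. 8.2 ("if") to an exhaustion with extendable stages.** To
prove `Literature.Topology.Immersions.Phillips1967_exists_isLocalDiffeomorph_of_isParallelizable`
it suffices to produce, on every connected non-compact `C^∞` `n`-manifold `M` (Hausdorff,
second countable, `2 ≤ n`) with a continuous global frame `σ`, an increasing sequence of subsets
`Kⱼ` with interiors covering `M`, a formal submersion holonomic near `K₁`, and the step
"holonomic near `K_{j+1}` ⟹ holonomic near `K_{j+2}`, same map on `Kⱼ`" — Phillips' handle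
presentation `Uⱼ` (Cor. 1.2) with the extension over collar-like enlargements (Lemma 4.7) and
handles of index `< n` (Lemmas 4.1, 5.1, §6). Combine
`exists_contMDiff_linearIndependent_frameDeriv_of_exhaustion` with the frame form of the fact
(`Phillips1967_exists_isLocalDiffeomorph_of_isParallelizable_of_frame`).
[cite: Phillips1967, Cor. 1.2, §6 and pp. 194–196] -/
theorem Phillips1967_exists_isLocalDiffeomorph_of_isParallelizable_of_exhaustion
    (h : ∀ (n : ℕ) (M : Type) [TopologicalSpace M] [T2Space M] [SecondCountableTopology M]
      [ChartedSpace (EuclideanSpace ℝ (Fin n)) M] [IsManifold (𝓡 n) ∞ M] [ConnectedSpace M]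
      [NoncompactSpace M] (σ : Fin n → M → EuclideanSpace ℝ (Fin n)),
      2 ≤ n →
      (∀ i, Continuous fun x => (⟨x, σ i x⟩ : TangentBundle (𝓡 n) M)) →
      (∀ x, LinearIndependent ℝ fun i => σ i x) →
        ∃ K : ℕ → Set M, (∀ j, K j ⊆ K (j + 1)) ∧ (∀ x, ∃ j, x ∈ interior (K j)) ∧
          (∃ (f : M → EuclideanSpace ℝ (Fin n)) (Ψ : M → Fin n → EuclideanSpace ℝ (Fin n)),
            HolonomicNear σ f Ψ (K 1)) ∧
          ∀ (j : ℕ) (f : M → EuclideanSpace ℝ (Fin n))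
            (Ψ : M → Fin n → EuclideanSpace ℝ (Fin n)), HolonomicNear σ f Ψ (K (j + 1)) →
            ∃ (g : M → EuclideanSpace ℝ (Fin n)) (Φ : M → Fin n → EuclideanSpace ℝ (Fin n)),
              HolonomicNear σ g Φ (K (j + 2)) ∧ EqOn g f (K j)) :
    Phillips1967_exists_isLocalDiffeomorph_of_isParallelizable := by
  refine Phillips1967_exists_isLocalDiffeomorph_of_isParallelizable_of_frame
    fun n M _ _ _ _ _ _ _ σ hn hσ hli => ?_
  obtain ⟨K, hmono, hcov, h0, hstep⟩ := h n M σ hn hσ hli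
  obtain ⟨F, hF, hFli⟩ :=
    exists_contMDiff_linearIndependent_frameDeriv_of_exhaustion K hmono hcov h0 hstep
  exact ⟨F, hF, hFli⟩

end Scheme

/-! ### The base of the induction: holonomic formal submersions near a point -/

section Base

variable [IsManifold (𝓡 n) ∞ M] {σ : Fin n → M → 𝔼 n}

variable [T2Space M]

/-- **Local existence of holonomic formal submersions** (the base of the induction: Phillips
1967, §2 — a disc submerges, with prescribed differential at the centre — in the
formal-solution language; "any section is holonomic over any point", EM 2001, §1.1). Let `σ` be a
continuous global frame of the `C^∞` `n`-manifold `M` (Hausdorff). Every point `x₀` has an open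
neighbourhood `V` carrying a formal submersion `(f, Ψ)` of `M` holonomic near `V`: with
`φ = extChartAt x₀` and a smooth bump function `χ` supported in the chart domain and `= 1` near
`x₀`, take `f = χ • φ` (so `f = φ` near `x₀`) and `Ψ x = J_σ φ (ρ x)`, where
`ρ x = φ⁻¹ (φ x₀ + χ x • (φ x - φ x₀))` on the chart domain and `ρ x = x₀` elsewhere — a
continuous map into the chart domain, the identity near `x₀` (radial contraction in the chart,
cf. Phillips' homotopy `h_t(x) = t⁻¹ (f(tx) - f(0))`, §2 Lemma 2.1) — whose values are
linearly independent because `d φ` is invertible on the chart domain.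
[cite: Phillips1967, §2, Lemma 2.1 and Lemma 2.4] -/
theorem exists_holonomicNear_nhds
    (hσ : ∀ i, Continuous fun x => (⟨x, σ i x⟩ : TangentBundle (𝓡 n) M))
    (hli : ∀ x, LinearIndependent ℝ fun i => σ i x) (x₀ : M) :
    ∃ V : Set M, IsOpen V ∧ x₀ ∈ V ∧
      ∃ (f : M → 𝔼 n) (Ψ : M → Fin n → 𝔼 n), HolonomicNear σ f Ψ V := by
  classical
  -- notation: the chart `φ` at `x₀`, its centre `c`, a bump `χ`
  set φ := extChartAt (𝓡 n) x₀ with hφ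
  set S := (chartAt (𝔼 n) x₀).source with hS
  set c : 𝔼 n := φ x₀ with hc
  obtain ⟨χ⟩ : Nonempty (SmoothBumpFunction (𝓡 n) x₀) := inferInstance
  have hSφ : S = φ.source := (extChartAt_source (𝓡 n) x₀).symm
  -- the contraction `ρ`
  set p : M → 𝔼 n := fun x => c + χ x • (φ x - c) with hp
  have hp_mem : ∀ x ∈ S, p x ∈ φ.target := by
    intro x hx
    by_cases hχ : χ x = 0
    · have : p x = c := by simp [hp, hχ]
      rw [this]
      exact mem_extChartAt_target x₀
    · have hxs : x ∈ support χ := hχ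
      rw [χ.support_eq_inter_preimage] at hxs
      have hd : dist (φ x) c < χ.rOut := hxs.2
      refine χ.ball_subset ⟨?_, mem_range_self _⟩
      rw [dist_eq_norm] at hd
      rw [mem_ball, dist_eq_norm]
      have h01 := χ.mem_Icc (x := x)
      calc ‖p x - c‖ = ‖χ x • (φ x - c)‖ := by simp [hp]
        _ = χ x * ‖φ x - c‖ := by rw [norm_smul, Real.norm_of_nonneg h01.1]
        _ ≤ 1 * ‖φ x - c‖ := by gcongr; exact h01.2
        _ < χ.rOut := by rwa [one_mul]
  set ρ : M → M := fun x => if x ∈ S then φ.symm (p x) else x₀ with hρ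
  have hρ_mem : ∀ x, ρ x ∈ S := by
    intro x
    by_cases hx : x ∈ S
    · simp only [hρ, hx, if_true]
      rw [hSφ]
      exact φ.map_target (hp_mem x hx)
    · simp only [hρ, hx, if_false]
      exact mem_chart_source (𝔼 n) x₀
  -- `ρ = x₀` off the support of `χ`, `ρ = id` where `χ = 1`
  have hρ_of_zero : ∀ x, χ x = 0 → ρ x = x₀ := by
    intro x hχ
    by_cases hx : x ∈ S
    · simp only [hρ, hx, if_true]
      have : p x = c := by simp [hp, hχ]
      rw [this, hc, hφ]
      exact extChartAt_to_inv x₀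
    · simp only [hρ, hx, if_false]
  have hρ_of_one : ∀ x ∈ S, χ x = 1 → ρ x = x := by
    intro x hx hχ
    simp only [hρ, hx, if_true]
    have : p x = φ x := by simp [hp, hχ]
    rw [this]
    exact φ.left_inv (by rwa [← hSφ])
  -- continuity of `ρ`
  have hρ_cont : Continuous ρ := by
    have hS_open : IsOpen S := (chartAt (𝔼 n) x₀).open_source
    have h_on_S : ContinuousOn ρ S := by
      have hφc : ContinuousOn φ S := by
        rw [hSφ]
        exact continuousOn_extChartAt x₀
      have hpc : ContinuousOn p S :=
        continuousOn_const.add ((χ.continuous.continuousOn).smul (hφc.sub continuousOn_const))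
      have hcomp : ContinuousOn (fun x => φ.symm (p x)) S :=
        (continuousOn_extChartAt_symm x₀).comp hpc fun x hx => hp_mem x hx
      exact hcomp.congr fun x hx => by simp only [hρ, hx, if_true]
    have h_off : ContinuousOn ρ (tsupport χ)ᶜ := by
      refine (continuousOn_const (c := x₀)).congr fun x hx => ?_
      exact hρ_of_zero x (image_eq_zero_of_notMem_tsupport hx)
    have hunion : S ∪ (tsupport χ)ᶜ = univ := by
      refine eq_univ_of_forall fun x => ?_
      by_cases hx : x ∈ tsupport χ
      · exact Or.inl (χ.tsupport_subset_chartAt_source hx)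
      · exact Or.inr hx
    rw [← continuousOn_univ, ← hunion]
    exact h_on_S.union_of_isOpen h_off hS_open (isClosed_tsupport χ).isOpen_compl
  -- the formal derivative `Ψ` and the map `f`
  set Ψ : M → Fin n → 𝔼 n := fun x => frameDeriv σ φ (ρ x) with hΨ
  set f : M → 𝔼 n := fun x => χ x • φ x with hf
  have hf_smooth : ContMDiff (𝓡 n) (𝓡 n) ∞ f := χ.contMDiff_smul contMDiffOn_extChartAt
  -- the neighbourhood `V = {χ = 1}`-ball
  set V : Set M := S ∩ φ ⁻¹' ball c χ.rIn with hV
  have hV_open : IsOpen V := isOpen_extChartAt_preimage x₀ isOpen_ball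
  have hx₀V : x₀ ∈ V := ⟨mem_chart_source (𝔼 n) x₀, mem_ball_self χ.rIn_pos⟩
  have hχV : ∀ x ∈ V, χ x = 1 := fun x hx =>
    χ.one_of_dist_le hx.1 (le_of_lt (mem_ball.1 hx.2))
  have hfV : ∀ x ∈ V, f x = φ x := fun x hx => by simp [hf, hχV x hx]
  refine ⟨V, hV_open, hx₀V, f, Ψ, HolonomicNear.of_isOpen hV_open hf_smooth ?_ ?_ ?_⟩
  · -- continuity of `Ψ`
    exact (continuousOn_frameDeriv_extChartAt hσ x₀).comp_continuous hρ_cont hρ_mem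
  · -- linear independence
    exact fun x => linearIndependent_frameDeriv_extChartAt hli (hρ_mem x)
  · -- holonomy on `V`
    intro x hx
    have hρx : ρ x = x := hρ_of_one x hx.1 (hχV x hx)
    have hfφ : f =ᶠ[𝓝 x] φ :=
      mem_of_superset (hV_open.mem_nhds hx) fun y hy => hfV y hy
    simp only [hΨ, hρx]
    exact (frameDeriv_congr_of_eventuallyEq hfφ).symm

end Base

end Literature.Topology.Immersions
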